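import Mathlib
import Summits.NavierStokesRegularity.NavierStokesRegularity.Theorems.ThreadingFluxHorizonTowerQuadraticGeneratorMixed
import Summits.NavierStokesRegularity.NavierStokesRegularity.Theorems.ThreadingFluxHorizonTowerTwoFourSixDigits
import Summits.NavierStokesRegularity.NavierStokesRegularity.Theorems.ThreadingFluxHorizonTowerFiniteTowerThreeShell
import HarnessLib

/-!
# Crux `PoloidalLiouville` (stmt-NavierStokesRegularity-1222), crux idea «horizon-threading-tower» (ns-idea-15):
# FINITE TOWERS AT ORDER ONE — THM G: THE TOWER `{4, 6, 8}` IS COAXIALLY ZONAL (third cone digit with a free quartic shell)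

Support file (`--supports stmt-NavierStokesRegularity-1222`, helper; cell `ns-wall-extremal`, width hand ns-wall-eng-3 g5; 0 kit).

`{4, 6, 8}`: one parity, non-coprime top pair `(6, 8) = 2·(3, 4)`, and the third degree is `D′ − 2 = 4` — so, unlike `{2, 6, 8}`, the
third shell `P₄ ∈ 𝓗₄` COMPETES at the second digit.  After the null-cone digit (`P₆ = c₁·77π₆(L³)`, `P₈ = c₂·2145π₈(L⁴)` for one real
quadratic generator `L`, as in THM F), the class identity `15{P₆,P₈} + 26ρ{P₄,P₈} + 11ρ²{P₄,P₆} = 0` gives at the SECOND digit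
`{65P₄ + 9c₁A′, L} ≡ 0 mod ρ` (`A′ = 35π₄(LM)`), hence by the null-cone structure lemma `65P₄ = κA − 9c₁A′` (`A = 35π₄(L²)`); at the
THIRD digit the closed form `classIdentity468_span` leaves `W · ρ² · (L²(k_M M + k_L L) + ρ·…) = 0` with `k_M = −285405120 c₁c₂ ≠ 0`,
so either `W = det(x,Qx,Q²x) = 0` or `M ≡ −(k_L/k_M) L mod ρ`; in both cases `Q` is uniaxial (same-degree rigidity p684047 / chart
injectivity, then `exists_axis_of_genM_eq`), the top shell is zonal and THM A descends.

* ★★ `finiteTower_exists_axis_of_fourSixEight` (polynomial level), ★★ `finiteTower_zonal_of_fourSixEight` (`A ∈ 𝓗₄` possibly zero,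
  `B ∈ 𝓗₆`, `C ∈ 𝓗₈` non-zero ⇒ one common axis), `finiteTower_zonalForm_of_fourSixEight`.

HONEST LABEL: one more cell of the crux-idea CONJECTURE `HorizonTowerZonality` at ORDER ONE (third all-one-parity, non-coprime-top cell;
the first with a competing free shell); `{2,4,8}`, `{2,4,6,8}`, `{1,3,9}`, … and the general tower stay OPEN; `PoloidalLiouville`
(1222), `UnthreadedRigidity` (27585) OPEN; W1 movement 0; NS regularity NOT proved.  [folklore]
-/

-- the summit and its single sub-problem share the name (CONVENTIONS §1)
set_option linter.dupNamespace false

noncomputable section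

open MvPolynomial Complex
open scoped Polynomial RealInnerProductSpace
open Literature.Analysis.FluidPDE (cross)

namespace Summit.NavierStokesRegularity.NavierStokesRegularity.Theorems.PoloidalLiouville.HorizonTower

/-! ### Polynomial level -/

/-- ★★ **THM G, polynomial level.**  In a scale-free tower `U_{H₄} + U_{H₆} + U_{H₈}` of horizon profiles annihilated by the order-one
horizon law off the centre, with polynomial models `P₆, P₈ ≠ 0`, the top shell is annihilated by the rotation derivative about some real
axis `n ≠ 0`. [folklore] -/
theorem finiteTower_exists_axis_of_fourSixEight (H : ℕ → E3 → ℝ)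
    (hH : ∀ l ∈ ({4, 6, 8} : Finset ℕ), ContDiff ℝ (⊤ : ℕ∞) (H l))
    (hhom : ∀ l ∈ ({4, 6, 8} : Finset ℕ), ∀ (c : ℝ) (y : E3), H l (c • y) = c ^ l * H l y)
    (hharm : ∀ l ∈ ({4, 6, 8} : Finset ℕ), ∀ y, Laplacian.laplacian (H l) y = 0)
    (hL1 : ∀ x : E3, x ≠ 0 → horizonL1 (fun z => ∑ l ∈ ({4, 6, 8} : Finset ℕ), horizonProfile l (H l) 0 z) 0 x = 0)
    (P : ℕ → MvPolynomial (Fin 3) ℝ)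
    (hP : ∀ l ∈ ({4, 6, 8} : Finset ℕ), (P l).IsHomogeneous l ∧ Zonal.lapP (P l) = 0 ∧ ∀ y, H l y = Zonal.evalE (P l) y)
    (hP6 : P 6 ≠ 0) (hP8 : P 8 ≠ 0) :
    ∃ n : Fin 3 → ℝ, n ≠ 0 ∧ Zonal.detP (C (n 0) * X 0 + C (n 1) * X 1 + C (n 2) * X 2) (P 8) = 0 := by
  classical
  have hK : ∀ l ∈ ({4, 6, 8} : Finset ℕ), 1 ≤ l := by
    intro l hl; simp only [Finset.mem_insert, Finset.mem_singleton] at hl; omega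
  have h4K : (4 : ℕ) ∈ ({4, 6, 8} : Finset ℕ) := by simp
  have h6K : (6 : ℕ) ∈ ({4, 6, 8} : Finset ℕ) := by simp
  have h8K : (8 : ℕ) ∈ ({4, 6, 8} : Finset ℕ) := by simp
  have hρ0 : (Zonal.normSq : Zonal.RPoly) ≠ 0 := Zonal.rho_ne_zero
  -- the class identity
  have hE := finiteTower_classIdentity_fourSixEight H hH hhom hharm hL1 P (fun l hl => (hP l hl).2.2)
  -- the top pair `(6, 8)`: as in THM F
  set f : ℂ[X] := Zonal.chartT (map (algebraMap ℝ ℂ) (P 6)) with hf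
  set g : ℂ[X] := Zonal.chartT (map (algebraMap ℝ ℂ) (P 8)) with hg
  have hW := finiteTower_top_wronskian {4, 6, 8} H hK hH hhom hharm hL1 P (fun l hl => ⟨(hP l hl).1, (hP l hl).2.2⟩) h8K h6K
    (by norm_num) (by intro l hl; simp only [Finset.mem_insert, Finset.mem_singleton] at hl; omega)
    (by intro l hl hl8; simp only [Finset.mem_insert, Finset.mem_singleton] at hl; omega)
  have hW' : (3 : ℂ[X]) * f * Polynomial.derivative g = (4 : ℂ[X]) * g * Polynomial.derivative f := by
    have h2 : (2 : ℂ[X]) * ((3 : ℂ[X]) * f * Polynomial.derivative g - (4 : ℂ[X]) * g * Polynomial.derivative f) = 0 := by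
      rw [← hf, ← hg] at hW
      linear_combination hW
    exact sub_eq_zero.mp ((mul_eq_zero.mp h2).resolve_left two_ne_zero)
  have hWr := Zonal.wronskian_pow_pow_eq_zero (a := 3) (b := 4) (by norm_num) (by norm_num)
    (by exact_mod_cast hW')
  have hg0 : g ≠ 0 := fun h => hP8 (Zonal.eq_zero_of_chartT_map_eq_zero (hP 8 h8K).1 (hP 8 h8K).2.1 h)
  have hf0 : f ≠ 0 := fun h => hP6 (Zonal.eq_zero_of_chartT_map_eq_zero (hP 6 h6K).1 (hP 6 h6K).2.1 h)
  obtain ⟨c, hc⟩ := Zonal.exists_C_mul_of_wronskian_eq_zero (pow_ne_zero _ hg0) hWr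
  set lc : ℂ := g.leadingCoeff with hlc
  obtain ⟨q, hqm, hgq, hdeg⟩ := Zonal.exists_monic_eq_C_mul_pow_of_coprime (a := 4) (b := 3) (by decide) (by norm_num) hf0 hc
  rw [← hlc] at hgq
  have hq0 : q ≠ 0 := hqm.ne_zero
  have hq4 : q.natDegree ≤ 4 := by
    have h1 : g.natDegree ≤ 2 * 8 := Zonal.natDegree_chartT_le (((hP 8 h8K).1).map (algebraMap ℝ ℂ))
    omega
  have hf4 : f ^ 4 = Polynomial.C (c * lc ^ 3) * (q ^ 3) ^ 4 := by
    rw [hc, hgq, mul_pow, ← Polynomial.C_pow, ← mul_assoc, ← Polynomial.C_mul]; ring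
  obtain ⟨γ, hγ⟩ := Zonal.exists_eq_C_mul_pow_of_pow_eq (D := 4) (d := 3) (by norm_num) hq0 hf4
  obtain ⟨qa, qb, qd, qe, qf, hgen⟩ := Zonal.exists_gen_chartT_eq hq4
  rw [← hgen] at hγ hgq
  have hP6c : map (algebraMap ℝ ℂ) (P 6) = C (γ / 77) * Zonal.genB qa qb qd qe qf :=
    Zonal.eq_C_mul_genB_of_chartT_eq qa qb qd qe qf (((hP 6 h6K).1).map _)
      (by rw [← Zonal.map_lapP, (hP 6 h6K).2.1, map_zero]) hγ
  have hP8c : map (algebraMap ℝ ℂ) (P 8) = C (lc / 2145) * Zonal.genC qa qb qd qe qf :=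
    Zonal.eq_C_mul_genC_of_chartT_eq qa qb qd qe qf (((hP 8 h8K).1).map _)
      (by rw [← Zonal.map_lapP, (hP 8 h8K).2.1, map_zero]) hgq
  obtain ⟨w, ra, rb, rd, re, rf, hwa, hwb, hwd, hwe, hwf⟩ := Zonal.exists_real_gen_of_map_eq_C_mul_genB_genC hP6 hP8 hP6c hP8c
  rw [hwa, hwb, hwd, hwe, hwf] at hP6c hP8c hgen
  have hmapB : map (algebraMap ℝ ℂ) (Zonal.genB ra rb rd re rf) = Zonal.genB (ra : ℂ) rb rd re rf := by
    rw [Zonal.map_genB]; rfl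
  have hmapC : map (algebraMap ℝ ℂ) (Zonal.genC ra rb rd re rf) = Zonal.genC (ra : ℂ) rb rd re rf := by
    rw [Zonal.map_genC]; rfl
  have hmapL : map (algebraMap ℝ ℂ) (Zonal.genL ra rb rd re rf) = Zonal.genL (ra : ℂ) rb rd re rf := by
    rw [Zonal.map_genL]; rfl
  have hmapA : map (algebraMap ℝ ℂ) (Zonal.genA ra rb rd re rf) = Zonal.genA (ra : ℂ) rb rd re rf := by
    rw [Zonal.map_genA]; rfl
  rw [Zonal.genB_smul, ← mul_assoc, ← map_mul, ← hmapB] at hP6c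
  rw [Zonal.genC_smul, ← mul_assoc, ← map_mul, ← hmapC] at hP8c
  have hB0 : Zonal.genB ra rb rd re rf ≠ 0 := by
    intro h0
    rw [h0, map_zero, mul_zero, map_eq_zero_iff _ (map_injective (algebraMap ℝ ℂ) (RCLike.ofReal_injective))] at hP6c
    exact hP6 hP6c
  have hC0 : Zonal.genC ra rb rd re rf ≠ 0 := by
    intro h0
    rw [h0, map_zero, mul_zero, map_eq_zero_iff _ (map_injective (algebraMap ℝ ℂ) (RCLike.ofReal_injective))] at hP8c
    exact hP8 hP8c
  obtain ⟨c₁, hc₁⟩ := LoopLaw.exists_real_smul_of_map_eq_C_mul hB0 hP6c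
  obtain ⟨c₂, hc₂⟩ := LoopLaw.exists_real_smul_of_map_eq_C_mul hC0 hP8c
  rw [smul_eq_C_mul] at hc₁ hc₂
  have hc₁0 : c₁ ≠ 0 := by rintro rfl; exact hP6 (by rw [hc₁, C_0, zero_mul])
  have hc₂0 : c₂ ≠ 0 := by rintro rfl; exact hP8 (by rw [hc₂, C_0, zero_mul])
  have hL0 : Zonal.genL ra rb rd re rf ≠ 0 := by
    intro h0
    apply hq0
    rw [← hgen, Zonal.genL_smul, ← hmapL, h0, map_zero, mul_zero, Zonal.chartT_zero]
  have hLc0 : Zonal.genL (ra : ℂ) rb rd re rf ≠ 0 := by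
    intro h0; apply hL0
    exact map_injective (algebraMap ℝ ℂ) (RCLike.ofReal_injective) (by rw [hmapL, h0, map_zero])
  set L := Zonal.genL ra rb rd re rf with hLdef
  set M := Zonal.genM ra rb rd re rf with hMdef
  -- the harmonic companion `M₀` of `M` and the uniaxial exit
  set M₀ : Zonal.RPoly := M - C (Zonal.genTau ra rb rd re rf / 3) * Zonal.normSq with hM₀
  have hM₀h : M₀.IsHomogeneous 2 := (Zonal.isHomogeneous_genM ra rb rd re rf).sub (Zonal.isHomogeneous_normSq.C_mul _)
  have hM₀l : Zonal.lapP M₀ = 0 := by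
    rw [hM₀, Zonal.lapP_sub, Zonal.lapP_C_mul, Zonal.lapP_genM, Zonal.lapP_normSq, ← map_mul, ← map_sub,
      show 2 * Zonal.genTau ra rb rd re rf - Zonal.genTau ra rb rd re rf / 3 * 6 = 0 by ring, map_zero]
  have exit_of_span : ∀ β : ℝ, M₀ = C β * L →
      ∃ n : Fin 3 → ℝ, n ≠ 0 ∧ Zonal.detP (C (n 0) * X 0 + C (n 1) * X 1 + C (n 2) * X 2) (P 8) = 0 := by
    intro β hβ
    have hM : Zonal.genM ra rb rd re rf = C β * Zonal.genL ra rb rd re rf + C (Zonal.genTau ra rb rd re rf / 3) * Zonal.normSq := by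
      rw [← hLdef, ← hβ, hM₀]; ring
    obtain ⟨n, hn, hrot⟩ := Zonal.exists_axis_of_genM_eq ra rb rd re rf hM
    refine ⟨n, hn, ?_⟩
    rw [hc₂, Zonal.detP_C_mul_right, Zonal.detP_genC_right, hM, Zonal.detP_add_right, Zonal.detP_C_mul_right,
      Zonal.detP_C_mul_right, Zonal.detP_normSq_right, hrot]
    ring
  -- (1) the second digit: `{65 P₄ + 9 c₁ A′, L}` dies on the null cone
  rw [hc₁, hc₂] at hE
  have hE' := hE
  rw [Zonal.classIdentity468_expand] at hE'
  have hT := (mul_eq_zero.mp hE').resolve_left hρ0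
  set X : Zonal.RPoly := C (223080 * c₂) * P 4 + C (30888 * c₁ * c₂) * Zonal.genAp ra rb rd re rf with hXdef
  have hXh : X.IsHomogeneous 4 := ((hP 4 h4K).1.C_mul _).add ((Zonal.isHomogeneous_genAp ra rb rd re rf).C_mul _)
  have hXl : Zonal.lapP X = 0 := by
    rw [hXdef, Zonal.lapP_add, Zonal.lapP_C_mul, Zonal.lapP_C_mul, (hP 4 h4K).2.1, Zonal.lapP_genAp, mul_zero, mul_zero,
      add_zero]
  have hApL : Zonal.detP (Zonal.genAp ra rb rd re rf) L = -(C 140 * L * Zonal.genW ra rb rd re rf) := by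
    rw [Zonal.detP_antisymm, Zonal.detP_genL_genAp]
  have hT0 : C (223080 * c₂) * L ^ 3 * Zonal.detP (P 4) L - C (4324320 * c₁ * c₂) * L ^ 4 * Zonal.genW ra rb rd re rf
      = L ^ 3 * Zonal.detP X L := by
    rw [hXdef, Zonal.detP_add_left, Zonal.detP_C_mul_left, Zonal.detP_C_mul_left, hApL]
    simp only [map_mul, map_ofNat]
    ring
  rw [hT0] at hT
  have hLc : Zonal.chartT (map (algebraMap ℝ ℂ) L) ≠ 0 := fun h0 =>
    hL0 (Zonal.eq_zero_of_chartT_map_eq_zero (Zonal.isHomogeneous_genL ra rb rd re rf) (Zonal.lapP_genL ra rb rd re rf) h0)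
  have hXchart : Zonal.chartT (map (algebraMap ℝ ℂ) (Zonal.detP X L)) = 0 := by
    have h1 := congrArg (fun p : Zonal.RPoly => Zonal.chartT (map (algebraMap ℝ ℂ) p)) hT
    simp only [map_add, map_mul, map_pow, Zonal.map_normSq, Zonal.chartT_add, Zonal.chartT_mul, Zonal.chartT_pow,
      Zonal.chartT_normSq, zero_mul, add_zero, map_zero, Zonal.chartT_zero] at h1
    exact (mul_eq_zero.mp h1).resolve_left (pow_ne_zero 3 hLc)
  -- the structure lemma: `X = κ A`
  obtain ⟨γ', hγ'⟩ : ∃ γ' : ℂ, map (algebraMap ℝ ℂ) X = C γ' * Zonal.genA (ra : ℂ) rb rd re rf := by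
    refine Zonal.exists_eq_C_mul_genA_of_chartT_detP_genL (hXh.map _) (by rw [← Zonal.map_lapP, hXl, map_zero]) hLc0 ?_
    rw [← hmapL, ← Zonal.map_detP]
    exact hXchart
  rw [← hmapA] at hγ'
  have hA0 : Zonal.genA ra rb rd re rf ≠ 0 := by
    intro h0
    have h1 := congrArg Zonal.chartT (congrArg (map (algebraMap ℝ ℂ)) h0)
    rw [hmapA, Zonal.chartT_genA, map_zero, Zonal.chartT_zero] at h1
    have h2 : Zonal.chartT (Zonal.genL (ra : ℂ) rb rd re rf) = 0 :=
      pow_eq_zero_iff (two_ne_zero) |>.mp ((mul_eq_zero.mp h1).resolve_left (Polynomial.C_ne_zero.mpr (by norm_num)))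
    exact hLc0 (Zonal.eq_zero_of_chartT_eq_zero (Zonal.isHomogeneous_genL _ _ _ _ _) (Zonal.lapP_genL _ _ _ _ _) h2)
  obtain ⟨κ₀, hκ₀⟩ := LoopLaw.exists_real_smul_of_map_eq_C_mul hA0 hγ'
  rw [smul_eq_C_mul] at hκ₀
  set κ : ℝ := κ₀ * (3432 * c₂)⁻¹ with hκ
  have h3432 : (3432 * c₂ : ℝ) ≠ 0 := mul_ne_zero (by norm_num) hc₂0
  have hP4eq : C 65 * P 4 = C κ * Zonal.genA ra rb rd re rf - C (9 * c₁) * Zonal.genAp ra rb rd re rf := by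
    have h1 : C 65 * P 4 = C ((3432 * c₂ : ℝ)⁻¹) * X - C (9 * c₁) * Zonal.genAp ra rb rd re rf := by
      rw [hXdef, mul_add, ← mul_assoc, ← mul_assoc, ← map_mul, ← map_mul,
        show (3432 * c₂ : ℝ)⁻¹ * (223080 * c₂) = 65 by field_simp; ring,
        show (3432 * c₂ : ℝ)⁻¹ * (30888 * c₁ * c₂) = 9 * c₁ by field_simp; ring]
      ring
    rw [h1, hκ₀, ← mul_assoc, ← map_mul, hκ, mul_comm κ₀]
  -- (2) the third digit: the closed form on the span
  have h65 : C (975 * c₁ * c₂) * Zonal.detP (Zonal.genB ra rb rd re rf) (Zonal.genC ra rb rd re rf)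
      + C (26 * c₂) * Zonal.normSq * Zonal.detP (C κ * Zonal.genA ra rb rd re rf - C (9 * c₁) * Zonal.genAp ra rb rd re rf)
        (Zonal.genC ra rb rd re rf)
      + C (11 * c₁) * Zonal.normSq ^ 2 * Zonal.detP (C κ * Zonal.genA ra rb rd re rf - C (9 * c₁) * Zonal.genAp ra rb rd re rf)
        (Zonal.genB ra rb rd re rf) = 0 := by
    have h1 := congrArg (fun p : Zonal.RPoly => C 65 * p) hE
    simp only [mul_zero] at h1
    rw [← hP4eq, Zonal.detP_C_mul_left, Zonal.detP_C_mul_left, ← h1, Zonal.detP_C_mul_left, Zonal.detP_C_mul_right,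
      Zonal.detP_C_mul_right, Zonal.detP_C_mul_right]
    simp only [map_mul, map_ofNat]
    ring
  rw [Zonal.classIdentity468_span] at h65
  rcases mul_eq_zero.mp h65 with hW0 | hpoly
  · rcases mul_eq_zero.mp hW0 with hρ2 | hW0
    · exact absurd hρ2 (pow_ne_zero 2 hρ0)
    · -- `W = 0`: `{L, M₀} = 0`, same-degree rigidity
      have hbr : Zonal.detP L M₀ = 0 := by
        rw [hM₀, Zonal.detP_sub_right, Zonal.detP_C_mul_right, Zonal.detP_normSq_right, mul_zero, sub_zero,
          Zonal.detP_genL_genM, hW0, mul_zero]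
      obtain ⟨β, hβ⟩ := LoopLaw.sameDegreeBracketRigidity 2 L M₀ (by norm_num)
        ⟨Zonal.isHomogeneous_genL ra rb rd re rf, Zonal.laplacian_eval_eq_zero_of_lapP (Zonal.lapP_genL ra rb rd re rf)⟩
        ⟨hM₀h, Zonal.laplacian_eval_eq_zero_of_lapP hM₀l⟩ hL0 (Zonal.bracket_eval_eq_zero_of_detP hbr)
      exact exit_of_span β (by rw [hβ, smul_eq_C_mul])
  · -- the `ρ²` digit is linear in `M` over `L²`: `k_M M₀ + k_L L` dies on the null cone, hence vanishes
    set Y : Zonal.RPoly := C (-285405120 * c₁ * c₂) * M₀ + C (-7138560 * c₂ * κ + 3201660 * c₁ ^ 2) * L with hYdef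
    have hYh : Y.IsHomogeneous 2 := (hM₀h.C_mul _).add ((Zonal.isHomogeneous_genL ra rb rd re rf).C_mul _)
    have hYl : Zonal.lapP Y = 0 := by
      rw [hYdef, Zonal.lapP_add, Zonal.lapP_C_mul, Zonal.lapP_C_mul, hM₀l, Zonal.lapP_genL, mul_zero, mul_zero, add_zero]
    have h1 := congrArg (fun p : Zonal.RPoly => Zonal.chartT (map (algebraMap ℝ ℂ) p)) hpoly
    have h2 : Zonal.chartT (map (algebraMap ℝ ℂ) (L ^ 2 * Y)) = 0 := by
      rw [hYdef, hM₀]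
      simp only [map_add, map_mul, map_pow, map_sub, map_neg, Zonal.map_normSq, Zonal.chartT_add, Zonal.chartT_mul,
        Zonal.chartT_pow, Zonal.chartT_sub, Zonal.chartT_neg, Zonal.chartT_normSq, zero_mul, mul_zero, add_zero, sub_zero,
        map_zero, Zonal.chartT_zero, map_C, Zonal.chartT_C, map_ofNat] at h1 ⊢
      linear_combination h1
    have hYchart : Zonal.chartT (map (algebraMap ℝ ℂ) Y) = 0 := by
      rw [map_mul, map_pow, Zonal.chartT_mul, Zonal.chartT_pow] at h2
      exact (mul_eq_zero.mp h2).resolve_left (pow_ne_zero 2 hLc)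
    have hY0 : Y = 0 := Zonal.eq_zero_of_chartT_map_eq_zero hYh hYl hYchart
    have hkM : (-285405120 * c₁ * c₂ : ℝ) ≠ 0 := mul_ne_zero (mul_ne_zero (by norm_num) hc₁0) hc₂0
    refine exit_of_span (-(-7138560 * c₂ * κ + 3201660 * c₁ ^ 2) * (-285405120 * c₁ * c₂)⁻¹) ?_
    have hM₀' : M₀ = C ((-285405120 * c₁ * c₂ : ℝ)⁻¹) * (C (-285405120 * c₁ * c₂) * M₀) := by
      rw [← mul_assoc, ← map_mul, inv_mul_cancel₀ hkM, map_one, one_mul]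
    rw [hM₀', show C (-285405120 * c₁ * c₂) * M₀ = -(C (-7138560 * c₂ * κ + 3201660 * c₁ ^ 2) * L) by
      rw [hYdef] at hY0; linear_combination hY0]
    simp only [map_mul, map_neg]
    ring

/-! ### ★★ THM G -/

/-- The three-shell sum over `K = {4, 6, 8}`. [folklore] -/
theorem fourSixEight_sum_eq (A B Cc : E3 → ℝ) (z : E3) :
    ∑ k ∈ ({4, 6, 8} : Finset ℕ), horizonProfile k ((fun k => if k = 8 then Cc else if k = 6 then B else A) k) 0 z
      = horizonProfile 4 A 0 z + horizonProfile 6 B 0 z + horizonProfile 8 Cc 0 z :=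
  threeShell_sum_eq (l := 4) (m := 6) (n := 8) (by norm_num) (by norm_num) (by norm_num) A B Cc z

/-- ★★ **THM G — THE TOWER `{4, 6, 8}` IS COAXIALLY ZONAL AT ORDER ONE.**  Let `A ∈ 𝓗₄` (possibly zero), `B ∈ 𝓗₆`, `C ∈ 𝓗₈` be smooth
homogeneous harmonic shells with `B, C ≢ 0`.  If the scale-free tower `U_A + U_B + U_C` of their horizon profiles is annihilated by the
order-one horizon law `𝔏₁` off the centre, then the three shells are zonal about ONE common axis `a ≠ 0`. [folklore] -/
theorem finiteTower_zonal_of_fourSixEight {A B Cc : E3 → ℝ}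
    (hA : ContDiff ℝ (⊤ : ℕ∞) A) (hhomA : ∀ (c : ℝ) (y : E3), A (c • y) = c ^ 4 * A y) (hharmA : ∀ y, Laplacian.laplacian A y = 0)
    (hB : ContDiff ℝ (⊤ : ℕ∞) B) (hhomB : ∀ (c : ℝ) (y : E3), B (c • y) = c ^ 6 * B y) (hharmB : ∀ y, Laplacian.laplacian B y = 0)
    (hC : ContDiff ℝ (⊤ : ℕ∞) Cc) (hhomC : ∀ (c : ℝ) (y : E3), Cc (c • y) = c ^ 8 * Cc y)
    (hharmC : ∀ y, Laplacian.laplacian Cc y = 0) (hB0 : ∃ y, B y ≠ 0) (hC0 : ∃ y, Cc y ≠ 0)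
    (hL1 : ∀ x : E3, x ≠ 0 →
      horizonL1 (fun z => horizonProfile 4 A 0 z + horizonProfile 6 B 0 z + horizonProfile 8 Cc 0 z) 0 x = 0) :
    ∃ a : E3, a ≠ 0 ∧ (∀ y : E3, ⟪cross a y, gradient A y⟫ = 0) ∧ (∀ y : E3, ⟪cross a y, gradient B y⟫ = 0) ∧
      (∀ y : E3, ⟪cross a y, gradient Cc y⟫ = 0) := by
  classical
  set K : Finset ℕ := {4, 6, 8} with hKdef
  set Hs : ℕ → E3 → ℝ := fun k => if k = 8 then Cc else if k = 6 then B else A with hHs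
  have hH4 : Hs 4 = A := by simp [hHs]
  have hH6 : Hs 6 = B := by simp [hHs]
  have hH8 : Hs 8 = Cc := by simp [hHs]
  have hmem : ∀ k ∈ K, k = 4 ∨ k = 6 ∨ k = 8 := fun k hk => by simpa [hKdef] using hk
  have hK1 : ∀ k ∈ K, 1 ≤ k := by intro k hk; rcases hmem k hk with rfl | rfl | rfl <;> norm_num
  have hHs' : ∀ k ∈ K, ContDiff ℝ (⊤ : ℕ∞) (Hs k) := by
    intro k hk; rcases hmem k hk with rfl | rfl | rfl
    · rw [hH4]; exact hA
    · rw [hH6]; exact hB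
    · rw [hH8]; exact hC
  have hhom' : ∀ k ∈ K, ∀ (c : ℝ) (y : E3), Hs k (c • y) = c ^ k * Hs k y := by
    intro k hk; rcases hmem k hk with rfl | rfl | rfl
    · rw [hH4]; exact hhomA
    · rw [hH6]; exact hhomB
    · rw [hH8]; exact hhomC
  have hharm' : ∀ k ∈ K, ∀ y, Laplacian.laplacian (Hs k) y = 0 := by
    intro k hk; rcases hmem k hk with rfl | rfl | rfl
    · rw [hH4]; exact hharmA
    · rw [hH6]; exact hharmB
    · rw [hH8]; exact hharmC
  have hL1' : ∀ x : E3, x ≠ 0 → horizonL1 (fun z => ∑ k ∈ K, horizonProfile k (Hs k) 0 z) 0 x = 0 := by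
    intro x hx
    have hfun : (fun z => ∑ k ∈ K, horizonProfile k (Hs k) 0 z)
        = fun z => horizonProfile 4 A 0 z + horizonProfile 6 B 0 z + horizonProfile 8 Cc 0 z :=
      funext fun z => fourSixEight_sum_eq A B Cc z
    rw [hfun]; exact hL1 x hx
  obtain ⟨P, hP⟩ := finiteTower_exists_polys K Hs hHs' hhom' hharm'
  have hne : ∀ {l}, l ∈ K → (∃ y, Hs l y ≠ 0) → P l ≠ 0 := by
    intro l hl ⟨y, hy⟩ h
    apply hy
    rw [(hP l hl).2.2 y, h]
    simp [Zonal.evalE]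
  have h6K : (6 : ℕ) ∈ K := by simp [hKdef]
  have h8K : (8 : ℕ) ∈ K := by simp [hKdef]
  have hP6 : P 6 ≠ 0 := hne h6K (by rw [hH6]; exact hB0)
  have hP8 : P 8 ≠ 0 := hne h8K (by rw [hH8]; exact hC0)
  obtain ⟨n, hn, htop⟩ := finiteTower_exists_axis_of_fourSixEight Hs hHs' hhom' hharm' hL1' P hP hP6 hP8
  have hmax : ∀ k ∈ K, k ≤ 8 := by intro k hk; rcases hmem k hk with rfl | rfl | rfl <;> omega
  have hall := finiteTower_detP_lin_eq_zero_of_top K Hs hK1 hHs' hhom' hharm' hL1' P hP h8K hmax hP8 hn htop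
  have hna : (WithLp.toLp 2 n : E3) ≠ 0 := by
    intro h
    apply hn
    funext i
    have := congrArg (fun v : E3 => v i) h
    simpa using this
  have conv : ∀ {l}, l ∈ K → ∀ y : E3, ⟪cross (WithLp.toLp 2 n) y, gradient (Hs l) y⟫ = 0 := by
    intro l hl y
    have h := hall l hl
    rw [Zonal.detP_lin_eq_zero_iff] at h
    have := h y
    rwa [← show Hs l = Zonal.evalE (P l) from funext (hP l hl).2.2] at this
  refine ⟨WithLp.toLp 2 n, hna, ?_, ?_, ?_⟩
  · have := conv (by simp [hKdef] : (4 : ℕ) ∈ K); rwa [hH4] at this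
  · have := conv h6K; rwa [hH6] at this
  · have := conv h8K; rwa [hH8] at this

/-- THM G with the ZONAL FUNCTIONAL FORMS of the Defs twin as conclusion. [folklore] -/
theorem finiteTower_zonalForm_of_fourSixEight {A B Cc : E3 → ℝ}
    (hA : ContDiff ℝ (⊤ : ℕ∞) A) (hhomA : ∀ (c : ℝ) (y : E3), A (c • y) = c ^ 4 * A y) (hharmA : ∀ y, Laplacian.laplacian A y = 0)
    (hB : ContDiff ℝ (⊤ : ℕ∞) B) (hhomB : ∀ (c : ℝ) (y : E3), B (c • y) = c ^ 6 * B y) (hharmB : ∀ y, Laplacian.laplacian B y = 0)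
    (hC : ContDiff ℝ (⊤ : ℕ∞) Cc) (hhomC : ∀ (c : ℝ) (y : E3), Cc (c • y) = c ^ 8 * Cc y)
    (hharmC : ∀ y, Laplacian.laplacian Cc y = 0) (hB0 : ∃ y, B y ≠ 0) (hC0 : ∃ y, Cc y ≠ 0)
    (hL1 : ∀ x : E3, x ≠ 0 →
      horizonL1 (fun z => horizonProfile 4 A 0 z + horizonProfile 6 B 0 z + horizonProfile 8 Cc 0 z) 0 x = 0) :
    ∃ (a : E3) (gA gB gC : ℝ → ℝ), a ≠ 0 ∧
      (∀ y : E3, y ≠ 0 → A y = ‖y‖ ^ 4 * gA (⟪a, y⟫ / ‖y‖)) ∧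
      (∀ y : E3, y ≠ 0 → B y = ‖y‖ ^ 6 * gB (⟪a, y⟫ / ‖y‖)) ∧
      (∀ y : E3, y ≠ 0 → Cc y = ‖y‖ ^ 8 * gC (⟪a, y⟫ / ‖y‖)) := by
  obtain ⟨a, ha, hAa, hBa, hCa⟩ := finiteTower_zonal_of_fourSixEight hA hhomA hharmA hB hhomB hharmB hC hhomC hharmC hB0 hC0 hL1
  obtain ⟨gA, hgA⟩ := exists_zonalForm_of_inner_cross_gradient_eq_zero (l := 4) ha (hA.differentiable (by simp))
    (fun c y _ => hhomA c y) hAa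
  obtain ⟨gB, hgB⟩ := exists_zonalForm_of_inner_cross_gradient_eq_zero (l := 6) ha (hB.differentiable (by simp))
    (fun c y _ => hhomB c y) hBa
  obtain ⟨gC, hgC⟩ := exists_zonalForm_of_inner_cross_gradient_eq_zero (l := 8) ha (hC.differentiable (by simp))
    (fun c y _ => hhomC c y) hCa
  exact ⟨a, gA, gB, gC, ha, hgA, hgB, hgC⟩

end Summit.NavierStokesRegularity.NavierStokesRegularity.Theorems.PoloidalLiouville.HorizonTower

end
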